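/-
Copyright (c) 2026 the pub-hodgecm-mathlib formalisation cell (harness21).  Prover seat hodgecm-mathlib-K2Liu-p01 (g2): Track B «K2-LIT»,
#184♮ = hLiu418 = stmt-HodgeConjecture-24832, STEWARD of socket #41; organ O41.5 (Gindikin–Karpelevich), ROADMAP
`K2/K2Liu-p01/g2/ROADMAP-O41_5-GindikinKarpelevich.K2Liup01g2.md` a6873eb1b770b760, sub-organ O41.5d at rank one.
-/
import Summits.HodgeConjecture.HodgeConjecture.Theorems.K2LiuUnipDeltaRankOneCoordinates  -- ★ rank-one coordinates + integrand profile
import Summits.HodgeConjecture.HodgeConjecture.Theorems.K2LiuGKRankOneIntegral          -- ★ the engine `integrable_and_integral_eq_of_shells`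
import Literature.NumberTheory.Automorphic.AddCharConductorExponent                     -- ★ `mem_primePowBall_adicCompletion_iff`
import HarnessLib

/-!
# Crux `HLiu418`, road `K2_Liu`, socket #41, organ O41.5d at RANK ONE: the value of the `U(1,1)` Gindikin–Karpelevich integral
# `∫_{F_v} φ°(w_Δ · n(ι_v b · δ)) db = μ(𝒪_v) · (1 − t)/(1 − q_v t)`,  `t = (∏_{w∣v} χ_w(ι_w ϖ_v)) · (∏_{w∣v} ‖ι_w ϖ_v‖_w)^{s+1/2}`

Cell `hodgecm-mathlib`, crux item hLiu418 = `stmt-HodgeConjecture-24832`; squad K2 ∕ K2Liu; prover K2Liu-p01 (g2), steward of #41.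
THEOREMS ONLY (no `def`, no instance, no notation, no named-fact hypothesis, no `sorry`); lane `--supports stmt-HodgeConjecture-24832`.

For the GR91 local frame at rank `n = 1` (`H(F_v) = U(T₀ ⊕ −T₀)(F_v) ≅ U(1,1)(F_v)`), a spherical section `φ°` of `I_v(s, χ_v)` (★ D10), a place `v`
with `|2|_w = |δ|_w = 1` and `χ_w` unramified at every `w ∣ v`, and a uniformizer `ϖ` of `F_v`:
* §1 bookkeeping on `E_w`: an unramified `χ_w` only sees valuations (`chi_eq_of_valued_eq_one`), `‖y‖_w = 1` for `|y|_w = 1`;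
* §2 the shell `𝔭_v^{-(m+1)} ∖ 𝔭_v^{-m}` is `|b|_v = exp(m+1)`, i.e. `b ϖ^{m+1}` is a unit (`valued_eq_exp_of_mem_shell`);
* §3 **THE PROFILE VALUE** `localSiegelCharacter_profile`: on that shell, `φ°(w_Δ n(ι_v b δ)) = t^{m+1}` with
  `t = α · P^{s+1/2}`, `α = ∏_{w∣v} χ_w(ι_w ϖ)`, `P = ∏_{w∣v} ‖ι_w ϖ‖_w` (★ `apply_weylDelta_mul_nElem_coord_of_one_le`: `φ° = χ_v(det_Δ p)|det_Δ p|^{s+1/2}`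
  with `det_Δ(p)_w = −ι_w(b⁻¹) δ⁻¹ = ι_w(ϖ)^{m+1} · (w-unit)`);
* §4 **THE RANK-ONE GINDIKIN–KARPELEVICH VALUE** `integral_apply_weylDelta_nElem_coord`: for any additive Haar measure `μ` on `F_v` and `‖t‖ < q_v⁻¹`,
  `b ↦ φ°(w_Δ n(ι_v b δ))` is integrable and `∫ φ°(w_Δ n(ι_v b δ)) dμ(b) = μ(𝒪_v) (1 − t)/(1 − q_v t)` (★ engine `integrable_and_integral_eq_of_shells`).
With `P = q_v^{-2}` (local norm compatibility `∏_{w∣v} ‖ι_w y‖_w = ‖y‖_v^{[E:F]}`, not used here) this is `μ(𝒪_v) · L_v(2s, χ⁰)/L_v(2s+1, χ⁰)`-shaped: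
`(1 − α q_v^{−2s−1})/(1 − α q_v^{−2s})`, the `c_{2e_i}` factor of [HarrisKudlaSweet1996, (6.14)–(6.16)].  The transport of the Haar measure of
`N_Δ(F_v)` to `μ` along `b ↦ n(ι_v b δ)` (ROADMAP (c-top)) is the remaining step to the `N_Δ`-form of the identity.
HONEST LABEL.  Count-neutral helper; it retires nothing by itself: `HC_CM` is proved only modulo the 7 printed citations (2 remaining named inputs:
hLiu418 = `stmt-HodgeConjecture-24832`, h413 = `stmt-HodgeConjecture-24833`) until rung 0 closes.

## References
* [HarrisKudlaSweet1996] M. Harris, S. Kudla, W. J. Sweet, J. AMS 9 (1996): §6 (6.14)–(6.16).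
* [Casselman1980] W. Casselman, Compositio Math. 40 (1980): §3 Thm. 3.1.   * [Kudla1994] S. S. Kudla, Israel J. Math. 87 (1994): §3.
* [Tate1950] J. Tate, thesis (1950): §2.2–2.5 (shells of a local field).
-/

set_option autoImplicit false
set_option linter.dupNamespace false -- the mandated namespace repeats `HodgeConjecture.HodgeConjecture`

noncomputable section

open NumberField IsDedekindDomain Matrix MeasureTheory
open scoped ValuativeRel NNReal
open Literature.NumberTheory.GaloisRepresentations.IsNonarchimedeanLocalField
open Literature.NumberTheory.Automorphic Literature.NumberTheory.Automorphic.UnitaryGroup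
open Literature.NumberTheory.GelbartRogawski1991.AdaptedBlocks
open Literature.NumberTheory.GelbartRogawski1991.UnitaryDualPair.LocalSplitting
open Literature.NumberTheory.K2Lit.LocalSiegelDoubled
open Summit.HodgeConjecture.HodgeConjecture.Cruxes.HLiu418.K2LiuUnipDeltaRankOneCoordinates
open Summit.HodgeConjecture.HodgeConjecture.Cruxes.HLiu418.K2LiuGKRankOneIntegral

namespace Summit.HodgeConjecture.HodgeConjecture.Cruxes.HLiu418.K2LiuGKRankOneValue

variable (F : Type) [Field F] [NumberField F] (E : Type) [Field E] [NumberField E] [Algebra F E]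
  [Algebra.IsQuadraticExtension F E] (c : E ≃ₐ[F] E) {δ : E} (hcδ : c δ = -δ) (hδ : δ ≠ 0) {d : F} (hd : δ * δ = algebraMap F E d)
  (v : HeightOneSpectrum (𝓞 F)) {T₀ : Matrix (Fin 1) (Fin 1) F} (hT₀ : T₀.IsSymm) (hT₀d : IsUnit T₀.det)
  {JD : Matrix (Fin (1 + 1)) (Fin (1 + 1)) E} (hJD : JD = (gramD F 1 T₀).map (algebraMap F E))

/-! ## §1 Bookkeeping on `E_w`: unramified characters and norms only see valuations -/

omit [NumberField F] [Algebra.IsQuadraticExtension F E] in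
/-- an unramified `χ_w` (trivial on `𝒪_w^×`) takes the same value on units with the same valuation. [cite: Casselman1980, §3] -/
theorem chi_eq_of_valued_eq_one {w : HeightOneSpectrum (𝓞 E)} (χw : (w.adicCompletion E)ˣ →* ℂˣ)
    (hχ : ∀ u : (w.adicCompletion E)ˣ, Valued.v (u : w.adicCompletion E) = 1 → χw u = 1) (u₁ u₂ : (w.adicCompletion E)ˣ)
    (h : Valued.v ((u₁ * u₂⁻¹ : (w.adicCompletion E)ˣ) : w.adicCompletion E) = 1) : χw u₁ = χw u₂ := by
  have h1 := hχ _ h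
  rwa [map_mul, map_inv, mul_inv_eq_one] at h1

omit [NumberField F] [Algebra.IsQuadraticExtension F E] in
/-- `‖y‖_w = 1` for `|y|_w = 1` (Mathlib's norm on `E_w` is the rank-one norm of the valuation). [folklore] -/
theorem norm_eq_one_of_valued_eq_one' {w : HeightOneSpectrum (𝓞 E)} {y : w.adicCompletion E} (h : Valued.v y = 1) : ‖y‖ = 1 :=
  le_antisymm (Valued.toNormedField.norm_le_one_iff.2 h.le) (Valued.toNormedField.one_le_norm_iff.2 h.ge)

/-! ## §2 The shell `𝔭_v^{-(m+1)} ∖ 𝔭_v^{-m}` of `F_v` -/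

omit [NumberField F] in
/-- **on the shell `𝔭^{-(m+1)} ∖ 𝔭^{-m}`, `|b|_v = exp(m+1)`.** [cite: Tate1950, §2.2] -/
theorem valued_eq_exp_of_mem_shell [NumberField F] (m : ℕ) {b : v.adicCompletion F}
    (hb : b ∈ primePowBall (v.adicCompletion F) (-((m : ℤ) + 1)) \ primePowBall (v.adicCompletion F) (-((m : ℤ) + 1) + 1)) :
    Valued.v b = WithZero.exp ((m : ℤ) + 1) := by
  rw [Set.mem_sdiff, mem_primePowBall_adicCompletion_iff, mem_primePowBall_adicCompletion_iff, neg_neg] at hb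
  have hb0 : Valued.v b ≠ 0 := fun h => hb.2 (by rw [h]; exact zero_le)
  rw [← WithZero.exp_log hb0, WithZero.exp_le_exp] at hb
  rw [← WithZero.exp_log hb0, WithZero.exp_inj]
  have h2 := hb.2
  rw [WithZero.exp_le_exp] at h2
  omega

omit [NumberField F] in
/-- on the shell, `u = b · ϖ^{m+1}` is a unit and `b ≠ 0`. [cite: Tate1950, §2.2] -/
theorem valued_mul_pow_eq_one [NumberField F] (m : ℕ) {ϖ b : v.adicCompletion F} (hϖ : Valued.v ϖ = WithZero.exp (-1 : ℤ))
    (hb : Valued.v b = WithZero.exp ((m : ℤ) + 1)) : Valued.v (b * ϖ ^ (m + 1)) = 1 := by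
  rw [map_mul, map_pow, hb, hϖ, ← WithZero.exp_nsmul, ← WithZero.exp_add, nsmul_eq_mul, Nat.cast_succ, mul_neg_one, add_neg_cancel,
    WithZero.exp_zero]

/-! ## §3 The profile value on the shell: `φ°(w_Δ n(ι_v b δ)) = t^{m+1}` -/

omit [Algebra.IsQuadraticExtension F E] in
/-- **`det_Δ(p)_w = ι_w(ϖ)^{m+1} · r_w` with `r_w = −ι_w(u⁻¹) δ⁻¹` a `w`-unit**, for `det_Δ(p)_w = −ι_w(b⁻¹) δ⁻¹` and `u = b ϖ^{m+1}`.
[cite: Kudla1994, §3] -/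
theorem detDelta_factor (m : ℕ) {ϖ b : v.adicCompletion F} (hϖ0 : ϖ ≠ 0) (w : PlacesOver E v) {x : w.1.adicCompletion E}
    (hx : x = -(toPlace v w b⁻¹ * ((δ⁻¹ : E) : w.1.adicCompletion E))) :
    x = toPlace v w ϖ ^ (m + 1) * -(toPlace v w (b * ϖ ^ (m + 1))⁻¹ * ((δ⁻¹ : E) : w.1.adicCompletion E)) := by
  have hk : toPlace v w ϖ ^ (m + 1) ≠ 0 := pow_ne_zero _ ((map_ne_zero (toPlace v w)).2 hϖ0)
  rw [hx, map_inv₀ (toPlace v w) b, map_inv₀ (toPlace v w) (b * ϖ ^ (m + 1)), map_mul, map_pow, mul_neg, neg_inj, mul_inv,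
    mul_comm (toPlace v w b)⁻¹ (toPlace v w ϖ ^ (m + 1))⁻¹, mul_assoc, ← mul_assoc (toPlace v w ϖ ^ (m + 1)), mul_inv_cancel₀ hk, one_mul]

omit [Algebra.IsQuadraticExtension F E] in
/-- the unit factor `r_w = −ι_w(u⁻¹) δ⁻¹` has valuation `1` (`u` a unit, `δ` a `w`-unit). [cite: Kudla1994, §3] -/
theorem valued_unitFactor_eq_one (w : PlacesOver E v) (hδw : Valued.v ((δ : E) : w.1.adicCompletion E) = 1) {u : v.adicCompletion F}
    (hu : Valued.v u = 1) : Valued.v (-(toPlace v w u⁻¹ * ((δ⁻¹ : E) : w.1.adicCompletion E))) = 1 := by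
  haveI := PlacesOver.liesOver w
  have hδ' : Valued.v ((δ⁻¹ : E) : w.1.adicCompletion E) = 1 := by
    rw [HeightOneSpectrum.adicCompletion.valued_coe] at hδw ⊢
    rw [map_inv₀, hδw, inv_one]
  rw [Valuation.map_neg, map_mul, hδ', mul_one, map_inv₀, map_inv₀, valued_toPlace, hu, one_pow, inv_one]

include hcδ hT₀d hJD in
/-- **THE PROFILE VALUE.**  On the shell `𝔭_v^{-(m+1)} ∖ 𝔭_v^{-m}`:
`φ°(w_Δ · n(ι_v b · δ)) = ((∏_{w∣v} χ_w(ι_w ϖ)) · (∏_{w∣v} ‖ι_w ϖ‖_w)^{s+1/2})^{m+1}` for a spherical section `φ°` of `I_v(s, χ_v)`, `χ_w` unramified,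
`|2|_w = |δ|_w = 1` (all `w ∣ v`), `ϖ` a uniformizer of `F_v`.  (★ `apply_weylDelta_mul_nElem_coord_of_one_le`: the value is `χ_v(det_Δ p)|det_Δ p|_v^{s+1/2}` with
`det_Δ(p)_w = ι_w(ϖ)^{m+1}·(w-unit)`; an unramified `χ_w` and `‖·‖_w` only see `ι_w(ϖ)^{m+1}`.)
[cite: HarrisKudlaSweet1996, §6 (6.14)–(6.16)] [cite: Casselman1980, §3 Thm. 3.1] [cite: Kudla1994, §3] -/
theorem localSiegelCharacter_profile (χv : ∀ w : PlacesOver E v, (w.1.adicCompletion E)ˣ →* ℂˣ) (s : ℂ)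
    {φ : UnitaryGroup.localPi E c (1 + 1) JD v → ℂ} (hφ : IsSphericalSection F E c hcδ hδ hd v 1 hT₀ hJD χv s φ)
    (h2 : ∀ w : PlacesOver E v, ValuativeRel.valuation (w.1.adicCompletion E) (2 : w.1.adicCompletion E) = 1)
    (hδw : ∀ w : PlacesOver E v, Valued.v ((δ : E) : w.1.adicCompletion E) = 1)
    (hχ : ∀ (w : PlacesOver E v) (u : (w.1.adicCompletion E)ˣ), Valued.v (u : w.1.adicCompletion E) = 1 → χv w u = 1)
    {ϖ : v.adicCompletion F} (hϖ : Valued.v ϖ = WithZero.exp (-1 : ℤ)) (hϖ0 : ∀ w : PlacesOver E v, toPlace v w ϖ ≠ 0) (m : ℕ)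
    {b : v.adicCompletion F} (hb : Valued.v b = WithZero.exp ((m : ℤ) + 1)) :
    φ (weylDelta F E c v 1 hJD *
        nElem F E c v 1 hJD (Matrix.of fun _ _ : Fin 1 => toLocalRing E v b * algebraMap E (LocalRing E v) δ) (skew_coord F E c hcδ v hT₀d b)) =
      ((((∏ w : PlacesOver E v, χv w (Units.mk0 (toPlace v w ϖ) (hϖ0 w))) : ℂˣ) : ℂ) *
          (((∏ w : PlacesOver E v, ‖toPlace v w ϖ‖) : ℝ) : ℂ) ^ (s + 1 / 2)) ^ (m + 1) := by
  have hb1 : 1 ≤ Valued.v b := by rw [hb, ← WithZero.exp_zero, WithZero.exp_le_exp]; positivity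
  have hϖ0' : ϖ ≠ 0 := fun h => by rw [h, map_zero] at hϖ; exact WithZero.zero_ne_coe hϖ
  have hu := valued_mul_pow_eq_one F v m hϖ hb
  obtain ⟨p, -, hdet, hφp⟩ := apply_weylDelta_mul_nElem_coord_of_one_le F E c hcδ hδ hd v hT₀ hT₀d hJD χv s hφ h2 hδw hb1
  rw [hφp]
  -- per-place factorisation `det_Δ(p)_w = ι_w(ϖ)^{m+1} r_w`, `|r_w|_w = 1`
  have hfac : ∀ w : PlacesOver E v, detDelta F E c v 1 w p =
      toPlace v w ϖ ^ (m + 1) * -(toPlace v w (b * ϖ ^ (m + 1))⁻¹ * ((δ⁻¹ : E) : w.1.adicCompletion E)) :=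
    fun w => detDelta_factor F E v m hϖ0' w (hdet w)
  have hr : ∀ w : PlacesOver E v, Valued.v (-(toPlace v w (b * ϖ ^ (m + 1))⁻¹ * ((δ⁻¹ : E) : w.1.adicCompletion E))) = 1 :=
    fun w => valued_unitFactor_eq_one F E v w (hδw w) hu
  have hr0 : ∀ w : PlacesOver E v, -(toPlace v w (b * ϖ ^ (m + 1))⁻¹ * ((δ⁻¹ : E) : w.1.adicCompletion E)) ≠ 0 :=
    fun w h => by have h1 := hr w; rw [h, map_zero] at h1; exact zero_ne_one h1
  have hunit : ∀ w : PlacesOver E v, IsUnit (detDelta F E c v 1 w p) := fun w => by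
    rw [hfac w]; exact ((IsUnit.mk0 _ (hϖ0 w)).pow _).mul (IsUnit.mk0 _ (hr0 w))
  -- `χ_v(det_Δ p) = α^{m+1}`
  have hchi : chiDet F E c v 1 χv p = (∏ w : PlacesOver E v, χv w (Units.mk0 (toPlace v w ϖ) (hϖ0 w))) ^ (m + 1) := by
    unfold chiDet
    rw [← Finset.prod_pow]
    refine Finset.prod_congr rfl fun w _ => ?_
    rw [dif_pos (hunit w), ← map_pow]
    refine chi_eq_of_valued_eq_one E (χv w) (hχ w) _ _ ?_
    rw [Units.val_mul, Units.val_inv_eq_inv_val, Units.val_pow_eq_pow_val, Units.val_mk0, IsUnit.unit_spec, hfac w,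
      mul_comm (toPlace v w ϖ ^ (m + 1)) _, mul_assoc, mul_inv_cancel₀ (pow_ne_zero _ (hϖ0 w)), mul_one]
    exact hr w
  -- `|det_Δ p|_v = P^{m+1}`
  have habs : absDetDelta F E c v 1 p = (∏ w : PlacesOver E v, ‖toPlace v w ϖ‖) ^ (m + 1) := by
    unfold absDetDelta
    rw [← Finset.prod_pow]
    refine Finset.prod_congr rfl fun w _ => ?_
    rw [hfac w, norm_mul, norm_pow, norm_eq_one_of_valued_eq_one' E (hr w), mul_one]
  -- assemble `α^{m+1} (P^{m+1})^{s+1/2} = (α P^{s+1/2})^{m+1}`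
  have hP0 : 0 < ∏ w : PlacesOver E v, ‖toPlace v w ϖ‖ := Finset.prod_pos fun w _ => norm_pos_iff.2 (hϖ0 w)
  unfold localSiegelCharacter
  rw [hchi, habs, Units.val_pow_eq_pow_val, Nat.cast_one, mul_pow]
  congr 1
  have hPn : ((((∏ w : PlacesOver E v, ‖toPlace v w ϖ‖) ^ (m + 1) : ℝ)) : ℂ) ≠ 0 := by exact_mod_cast (pow_pos hP0 _).ne'
  have hP0' : (((∏ w : PlacesOver E v, ‖toPlace v w ϖ‖) : ℝ) : ℂ) ≠ 0 := by exact_mod_cast hP0.ne'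
  rw [Complex.cpow_def_of_ne_zero hPn, Complex.cpow_def_of_ne_zero hP0', ← Complex.exp_nat_mul, ← Complex.ofReal_log (pow_pos hP0 _).le,
    Real.log_pow, ← Complex.ofReal_log hP0.le]
  push_cast
  ring_nf

/-! ## §4 The rank-one Gindikin–Karpelevich value -/

include hcδ hT₀d hJD in
/-- **THE RANK-ONE (`U(1,1)`) GINDIKIN–KARPELEVICH VALUE.**  For a spherical section `φ°` of `I_v(s, χ_v)` (`χ_w` unramified, `|2|_w = |δ|_w = 1` at every
`w ∣ v`), a uniformizer `ϖ` of `F_v`, ANY additive Haar measure `μ` on `F_v`, and `t := (∏_{w∣v} χ_w(ι_w ϖ)) · (∏_{w∣v} ‖ι_w ϖ‖_w)^{s+1/2}` with `‖t‖ < q_v⁻¹`: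
`b ↦ φ°(w_Δ · n(ι_v b · δ))` is integrable and **`∫_{F_v} φ°(w_Δ · n(ι_v b · δ)) dμ(b) = μ(𝒪_v) · (1 − t)/(1 − q_v t)`** — it is `1` on `𝒪_v`
(★ `apply_weylDelta_mul_nElem_coord_of_le_one`) and `t^{m+1}` on the sphere `|b|_v = q_v^{m+1}` (`localSiegelCharacter_profile`), so the ★ engine
`integrable_and_integral_eq_of_shells` applies.  With `∏_{w∣v} ‖ι_w ϖ‖_w = q_v^{-2}` this reads `μ(𝒪_v)(1 − α q_v^{−2s−1})/(1 − α q_v^{−2s})`, `α = ∏_{w∣v} χ_w(ι_w ϖ)`.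
[cite: HarrisKudlaSweet1996, §6 (6.14)–(6.16)] [cite: Casselman1980, §3 Thm. 3.1] [cite: Kudla1994, §3] -/
theorem integral_apply_weylDelta_nElem_coord [MeasurableSpace (v.adicCompletion F)] [BorelSpace (v.adicCompletion F)]
    (μ : Measure (v.adicCompletion F)) [μ.IsAddHaarMeasure]
    (χv : ∀ w : PlacesOver E v, (w.1.adicCompletion E)ˣ →* ℂˣ) (s : ℂ)
    {φ : UnitaryGroup.localPi E c (1 + 1) JD v → ℂ} (hφ : IsSphericalSection F E c hcδ hδ hd v 1 hT₀ hJD χv s φ)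
    (h2 : ∀ w : PlacesOver E v, ValuativeRel.valuation (w.1.adicCompletion E) (2 : w.1.adicCompletion E) = 1)
    (hδw : ∀ w : PlacesOver E v, Valued.v ((δ : E) : w.1.adicCompletion E) = 1)
    (hχ : ∀ (w : PlacesOver E v) (u : (w.1.adicCompletion E)ˣ), Valued.v (u : w.1.adicCompletion E) = 1 → χv w u = 1)
    {ϖ : v.adicCompletion F} (hϖ : Valued.v ϖ = WithZero.exp (-1 : ℤ)) (hϖ0 : ∀ w : PlacesOver E v, toPlace v w ϖ ≠ 0)
    (ht : ‖(((∏ w : PlacesOver E v, χv w (Units.mk0 (toPlace v w ϖ) (hϖ0 w))) : ℂˣ) : ℂ) *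
          (((∏ w : PlacesOver E v, ‖toPlace v w ϖ‖) : ℝ) : ℂ) ^ (s + 1 / 2)‖ < (residueFieldCard (v.adicCompletion F) : ℝ)⁻¹) :
    Integrable (fun b : v.adicCompletion F => φ (weylDelta F E c v 1 hJD *
        nElem F E c v 1 hJD (Matrix.of fun _ _ : Fin 1 => toLocalRing E v b * algebraMap E (LocalRing E v) δ) (skew_coord F E c hcδ v hT₀d b))) μ ∧
      ∫ b, φ (weylDelta F E c v 1 hJD *
          nElem F E c v 1 hJD (Matrix.of fun _ _ : Fin 1 => toLocalRing E v b * algebraMap E (LocalRing E v) δ) (skew_coord F E c hcδ v hT₀d b)) ∂μ =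
        μ.real (primePowBall (v.adicCompletion F) 0) *
          ((1 - ((((∏ w : PlacesOver E v, χv w (Units.mk0 (toPlace v w ϖ) (hϖ0 w))) : ℂˣ) : ℂ) *
                (((∏ w : PlacesOver E v, ‖toPlace v w ϖ‖) : ℝ) : ℂ) ^ (s + 1 / 2))) /
            (1 - (residueFieldCard (v.adicCompletion F) : ℂ) *
              ((((∏ w : PlacesOver E v, χv w (Units.mk0 (toPlace v w ϖ) (hϖ0 w))) : ℂˣ) : ℂ) *
                (((∏ w : PlacesOver E v, ‖toPlace v w ϖ‖) : ℝ) : ℂ) ^ (s + 1 / 2)))) := by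
  refine integrable_and_integral_eq_of_shells μ _ ht (fun b hb => ?_) (fun m b hb => ?_)
  · exact apply_weylDelta_mul_nElem_coord_of_le_one F E c hcδ hδ hd v hT₀ hT₀d hJD χv s hφ h2 hδw
      ((mem_primePowBall_zero_iff_valued F v b).1 hb)
  · exact localSiegelCharacter_profile F E c hcδ hδ hd v hT₀ hT₀d hJD χv s hφ h2 hδw hχ hϖ hϖ0 m (valued_eq_exp_of_mem_shell F v m hb)

end Summit.HodgeConjecture.HodgeConjecture.Cruxes.HLiu418.K2LiuGKRankOneValue

end
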